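import Summits.Ventures.CertifiedManyBodySolver.Observables.SourcedGibbsTrialCapAFRowsCompact
import Summits.Ventures.CertifiedManyBodySolver.Observables.SourcedGibbsTrialCapAFTwoGrid
import Literature.MathematicalPhysics.QuantumLattice.PairSourcedTorusGibbsTrialStateMixingEven
import HarnessLib

/-!
# The AF–BCS sourced cap in momentum space (XVI-e): the `hrows` of the even-torus mixing bridge from ONE certified grid

Cell hubbard-obs (seat hubbard-obs-pin-2). HONEST FRAMING: zero compute; the antiferromagnetic analogue of
`hfbcs_gibbs_rows_of_grid` (`SourcedGibbsTrialCapCanonical` §1) — `AF-TL-PACKAGING.md` step 4b. If the `L₁ = 2k₁`-grid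
momentum sums of the AF + `d`-wave-pinned BCS trial family at `(μ', β, h, M)` satisfy the certified interval
numerics `a ≤ S_c/L₁² ≤ b` (density coefficient), `sq ≤ S_q/L₁² ≤ tq` (staggered-moment coefficient), `S_w/L₁² ≤ sw`
(energy coefficient), with slack bounds `δ ≥ K_δ/L₁`, `ε ≥ K_ε/L₁` (`K_δ = 2π(β/2)(2 + 2√2|h|)`,
`K_ε = 2π(5/2)(2 + 2√2|h|)`, files XV-f/XV-g) and the two TANGENT conditions
`γ(sq − δ − σ₀) ≤ Γ`, `γ(tq + δ − σ₀) ≤ Γ` (`γ = −2Uσ₀ − 2M`, any anchor `σ₀`; the moment energy `−Uσ² − 2Mσ` is concave, so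
it lies below its tangent at `σ₀`), then on EVERY EVEN torus `L ≥ L₁` the Gibbs state of the Hermitian AF trial matrix
`B_L = A_L(0,μ',h) + Σ_x M(−1)^x(n_{x↑} − n_{x↓})` has number per site in `[2a − 2δ − c/L, 2b + 2δ + c/L]` and sourced
energy per site `≤ (2sw + 2ε − Uσ₀² − 2Mσ₀ + Γ) + μ'·n_L + U·n_L²/4 + c/L`, `c = 2K_δ + 2K_ε + |γ|K_δ` — the `hrows` shape
of `exists_isTranslationInvariant_density_eq_meanEnergy_sourced_le_of_two_gibbs_families_even`. (`U ≥ 0`, `β ≥ 0`,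
`μ' ≠ 0`, `M ≠ 0`.) A variational CAP; the field is a device; no statement about order; not a superconductivity verdict.

References: Bach–Lieb–Solovej (1994) §2 [BachLiebSolovej1994]; Davis–Rabinowitz (1984) §2.1 eq. (2.1.6)
[DavisRabinowitz1984]; Hirsch PRB 31 (1985) 4403 [HirschPRB1985].
-/

noncomputable section

open Real Finset Matrix Literature.MathematicalPhysics.QuantumLattice Literature.Probability.LatticeModels
open Literature.MathematicalPhysics.QuantumLattice.HubbardWave0

namespace Summit.Ventures.CertifiedManyBodySolver.Observables

section AFRows

set_option maxHeartbeats 1600000 in -- long explicit statement (momentum sums); elaboration, no search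
/-- **AF–BCS Gibbs family rows from one grid** (even tori; see the module docstring for the shape and constants).
[cite: BachLiebSolovej1994, §2] [cite: DavisRabinowitz1984, §2.1 eq. (2.1.6)] [cite: HirschPRB1985] -/
theorem afbcs_gibbs_rows_of_grid (k₁ : ℕ) [NeZero (2 * k₁)] (hk₁ : 3 ≤ 2 * k₁) {U : ℝ} (hU : 0 ≤ U) (μ' h M : ℝ)
    {β : ℝ} (hβ : 0 ≤ β) (hμ : μ' ≠ 0) (hM : M ≠ 0) {sw a b sq tq δ ε σ₀ Γ : ℝ}
    (hsw : (∑ p : TorusSite 2 (2 * k₁), ((torusBand (2 * k₁) p - μ') * (1 / 2 - Real.tanh (β * Real.sqrt ((Real.sqrt (torusBand (2 * k₁) p ^ 2 + M ^ 2) + |μ'|) ^ 2 + (2 * Real.sqrt 2 * h * dWaveGap p) ^ 2) / 2) / (2 * Real.sqrt ((Real.sqrt (torusBand (2 * k₁) p ^ 2 + M ^ 2) + |μ'|) ^ 2 + (2 * Real.sqrt 2 * h * dWaveGap p) ^ 2)) * ((torusBand (2 * k₁) p - μ') / 2 - μ' / (2 * |μ'| * Real.sqrt (torusBand (2 * k₁)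 p ^ 2 + M ^ 2)) * (torusBand (2 * k₁) p ^ 2 + M ^ 2 - torusBand (2 * k₁) p * μ')) - Real.tanh (β * Real.sqrt ((Real.sqrt (torusBand (2 * k₁) p ^ 2 + M ^ 2) - |μ'|) ^ 2 + (2 * Real.sqrt 2 * h * dWaveGap p) ^ 2) / 2) / (2 * Real.sqrt ((Real.sqrt (torusBand (2 * k₁) p ^ 2 + M ^ 2) - |μ'|) ^ 2 + (2 * Real.sqrt 2 * h * dWaveGap p) ^ 2)) * ((torusBand (2 * k₁) p - μ') / 2 + μ' / (2 * |μ'| * Real.sqrt (torusBand (2 * k₁) p ^ 2 + M ^ 2)) * (torusBand (2 * k₁) p ^ 2 + M ^ 2 - torusBand (2 * k₁) p * μ'))) + (2 * Real.sqrt 2 * h * dWaveGap p) * (-(2 * Real.sqrt 2 * h * dWaveGap p) * (Real.tanh (β * Real.sqrt ((Real.sqrt (torusBand (2 * k₁) p ^ 2 + M ^ 2) + |μ'|) ^ 2 + (2 * Real.sqrt 2 * h * dWaveGap p) ^ 2) / 2) / (2 * Real.sqrt ((Real.sqrt (torusBand (2 * k₁) p ^ 2 + M ^ 2) + |μ'|)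 ^ 2 + (2 * Real.sqrt 2 * h * dWaveGap p) ^ 2)) * (1 / 2 - μ' / (2 * |μ'| * Real.sqrt (torusBand (2 * k₁) p ^ 2 + M ^ 2)) * torusBand (2 * k₁) p) + Real.tanh (β * Real.sqrt ((Real.sqrt (torusBand (2 * k₁) p ^ 2 + M ^ 2) - |μ'|) ^ 2 + (2 * Real.sqrt 2 * h * dWaveGap p) ^ 2) / 2) / (2 * Real.sqrt ((Real.sqrt (torusBand (2 * k₁) p ^ 2 + M ^ 2) - |μ'|) ^ 2 + (2 * Real.sqrt 2 * h * dWaveGap p) ^ 2)) * (1 / 2 + μ' / (2 * |μ'| * Real.sqrt (torusBand (2 * k₁) p ^ 2 + M ^ 2)) * torusBand (2 * k₁) p))) + M * (-M * (Real.tanh (β * Real.sqrt ((Real.sqrt (torusBand (2 * k₁) p ^ 2 + M ^ 2) + |μ'|) ^ 2 + (2 * Real.sqrt 2 * h * dWaveGap p) ^ 2) / 2) / (2 * Real.sqrt ((Real.sqrt (torusBand (2 * k₁) p ^ 2 + M ^ 2) + |μ'|) ^ 2 + (2 * Real.sqrt 2 * h * dWaveGap p) ^ 2)) * (1 / 2 +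 μ' / (2 * |μ'| * Real.sqrt (torusBand (2 * k₁) p ^ 2 + M ^ 2)) * μ') + Real.tanh (β * Real.sqrt ((Real.sqrt (torusBand (2 * k₁) p ^ 2 + M ^ 2) - |μ'|) ^ 2 + (2 * Real.sqrt 2 * h * dWaveGap p) ^ 2) / 2) / (2 * Real.sqrt ((Real.sqrt (torusBand (2 * k₁) p ^ 2 + M ^ 2) - |μ'|) ^ 2 + (2 * Real.sqrt 2 * h * dWaveGap p) ^ 2)) * (1 / 2 - μ' / (2 * |μ'| * Real.sqrt (torusBand (2 * k₁) p ^ 2 + M ^ 2)) * μ'))))) / ((2 * k₁ : ℕ) : ℝ) ^ 2 ≤ sw)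
    (ha : a ≤ (∑ p : TorusSite 2 (2 * k₁), (1 / 2 - Real.tanh (β * Real.sqrt ((Real.sqrt (torusBand (2 * k₁) p ^ 2 + M ^ 2) + |μ'|) ^ 2 + (2 * Real.sqrt 2 * h * dWaveGap p) ^ 2) / 2) / (2 * Real.sqrt ((Real.sqrt (torusBand (2 * k₁) p ^ 2 + M ^ 2) + |μ'|) ^ 2 + (2 * Real.sqrt 2 * h * dWaveGap p) ^ 2)) * ((torusBand (2 * k₁) p - μ') / 2 - μ' / (2 * |μ'| * Real.sqrt (torusBand (2 * k₁) p ^ 2 + M ^ 2)) * (torusBand (2 * k₁) p ^ 2 + M ^ 2 - torusBand (2 * k₁) p * μ')) - Real.tanh (β * Real.sqrt ((Real.sqrt (torusBand (2 * k₁) p ^ 2 + M ^ 2) - |μ'|) ^ 2 + (2 * Real.sqrt 2 * h * dWaveGap p) ^ 2) / 2) / (2 * Real.sqrt ((Real.sqrt (torusBand (2 * k₁) p ^ 2 + M ^ 2) - |μ'|) ^ 2 + (2 * Real.sqrt 2 * h * dWaveGap p) ^ 2)) * ((torusBand (2 * k₁) p - μ') / 2 + μ' / (2 * |μ'| * Real.sqrt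 (torusBand (2 * k₁) p ^ 2 + M ^ 2)) * (torusBand (2 * k₁) p ^ 2 + M ^ 2 - torusBand (2 * k₁) p * μ')))) / ((2 * k₁ : ℕ) : ℝ) ^ 2)
    (hb : (∑ p : TorusSite 2 (2 * k₁), (1 / 2 - Real.tanh (β * Real.sqrt ((Real.sqrt (torusBand (2 * k₁) p ^ 2 + M ^ 2) + |μ'|) ^ 2 + (2 * Real.sqrt 2 * h * dWaveGap p) ^ 2) / 2) / (2 * Real.sqrt ((Real.sqrt (torusBand (2 * k₁) p ^ 2 + M ^ 2) + |μ'|) ^ 2 + (2 * Real.sqrt 2 * h * dWaveGap p) ^ 2)) * ((torusBand (2 * k₁) p - μ') / 2 - μ' / (2 * |μ'| * Real.sqrt (torusBand (2 * k₁) p ^ 2 + M ^ 2)) * (torusBand (2 * k₁) p ^ 2 + M ^ 2 - torusBand (2 * k₁) p * μ')) - Real.tanh (β * Real.sqrt ((Real.sqrt (torusBand (2 * k₁) p ^ 2 + M ^ 2) - |μ'|) ^ 2 + (2 * Real.sqrt 2 * h * dWaveGap p) ^ 2) / 2) / (2 * Real.sqrt ((Real.sqrt (torusBand (2 * k₁)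 p ^ 2 + M ^ 2) - |μ'|) ^ 2 + (2 * Real.sqrt 2 * h * dWaveGap p) ^ 2)) * ((torusBand (2 * k₁) p - μ') / 2 + μ' / (2 * |μ'| * Real.sqrt (torusBand (2 * k₁) p ^ 2 + M ^ 2)) * (torusBand (2 * k₁) p ^ 2 + M ^ 2 - torusBand (2 * k₁) p * μ')))) / ((2 * k₁ : ℕ) : ℝ) ^ 2 ≤ b)
    (hsq : sq ≤ (∑ p : TorusSite 2 (2 * k₁), (-M * (Real.tanh (β * Real.sqrt ((Real.sqrt (torusBand (2 * k₁) p ^ 2 + M ^ 2) + |μ'|) ^ 2 + (2 * Real.sqrt 2 * h * dWaveGap p) ^ 2) / 2) / (2 * Real.sqrt ((Real.sqrt (torusBand (2 * k₁) p ^ 2 + M ^ 2) + |μ'|) ^ 2 + (2 * Real.sqrt 2 * h * dWaveGap p) ^ 2)) * (1 / 2 + μ' / (2 * |μ'| * Real.sqrt (torusBand (2 * k₁) p ^ 2 + M ^ 2)) * μ') + Real.tanh (β * Real.sqrt ((Real.sqrt (torusBand (2 * k₁) p ^ 2 + M ^ 2) - |μ'|) ^ 2 + (2 * Real.sqrt 2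 * h * dWaveGap p) ^ 2) / 2) / (2 * Real.sqrt ((Real.sqrt (torusBand (2 * k₁) p ^ 2 + M ^ 2) - |μ'|) ^ 2 + (2 * Real.sqrt 2 * h * dWaveGap p) ^ 2)) * (1 / 2 - μ' / (2 * |μ'| * Real.sqrt (torusBand (2 * k₁) p ^ 2 + M ^ 2)) * μ')))) / ((2 * k₁ : ℕ) : ℝ) ^ 2)
    (htq : (∑ p : TorusSite 2 (2 * k₁), (-M * (Real.tanh (β * Real.sqrt ((Real.sqrt (torusBand (2 * k₁) p ^ 2 + M ^ 2) + |μ'|) ^ 2 + (2 * Real.sqrt 2 * h * dWaveGap p) ^ 2) / 2) / (2 * Real.sqrt ((Real.sqrt (torusBand (2 * k₁) p ^ 2 + M ^ 2) + |μ'|) ^ 2 + (2 * Real.sqrt 2 * h * dWaveGap p) ^ 2)) * (1 / 2 + μ' / (2 * |μ'| * Real.sqrt (torusBand (2 * k₁) p ^ 2 + M ^ 2)) * μ') + Real.tanh (β * Real.sqrt ((Real.sqrt (torusBand (2 * k₁) p ^ 2 + M ^ 2) - |μ'|) ^ 2 + (2 * Real.sqrt 2 * h * dWaveGap p) ^ 2)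 / 2) / (2 * Real.sqrt ((Real.sqrt (torusBand (2 * k₁) p ^ 2 + M ^ 2) - |μ'|) ^ 2 + (2 * Real.sqrt 2 * h * dWaveGap p) ^ 2)) * (1 / 2 - μ' / (2 * |μ'| * Real.sqrt (torusBand (2 * k₁) p ^ 2 + M ^ 2)) * μ')))) / ((2 * k₁ : ℕ) : ℝ) ^ 2 ≤ tq)
    (hδ : (2 * Real.pi * (β / 4 * 2 * (2 + 2 * Real.sqrt 2 * |h|))) / ((2 * k₁ : ℕ) : ℝ) ≤ δ)
    (hε : (2 * Real.pi * (5 / 4 * 2 * (2 + 2 * Real.sqrt 2 * |h|))) / ((2 * k₁ : ℕ) : ℝ) ≤ ε)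
    (hΓ1 : (-2 * U * σ₀ - 2 * M) * (sq - δ - σ₀) ≤ Γ) (hΓ2 : (-2 * U * σ₀ - 2 * M) * (tq + δ - σ₀) ≤ Γ) :
    ∀ L : ℕ, 2 * k₁ ≤ L → Even L → ∀ [NeZero L],
      ∃ B : Matrix (Finset (Orb (FermionTorus 2 L))) (Finset (Orb (FermionTorus 2 L))) ℂ, B.IsHermitian ∧
        (2 * a - 2 * δ) - ((2 * Real.pi * (β / 4 * 2 * (2 + 2 * Real.sqrt 2 * |h|))) * 2 + (2 * Real.pi * (5 / 4 * 2 * (2 + 2 * Real.sqrt 2 * |h|))) * 2 + |-2 * U * σ₀ - 2 * M| * (2 * Real.pi * (β / 4 * 2 * (2 + 2 * Real.sqrt 2 * |h|)))) / (L : ℝ) ≤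
          (gibbsState β B totalNumber).re / (L : ℝ) ^ 2 ∧
        (gibbsState β B totalNumber).re / (L : ℝ) ^ 2 ≤
          (2 * b + 2 * δ) + ((2 * Real.pi * (β / 4 * 2 * (2 + 2 * Real.sqrt 2 * |h|))) * 2 + (2 * Real.pi * (5 / 4 * 2 * (2 + 2 * Real.sqrt 2 * |h|))) * 2 + |-2 * U * σ₀ - 2 * M| * (2 * Real.pi * (β / 4 * 2 * (2 + 2 * Real.sqrt 2 * |h|)))) / (L : ℝ) ∧
        (gibbsState β B (dWaveSourceTorusTT' L 0 U 0 h)).re / (L : ℝ) ^ 2 ≤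
          (2 * sw + 2 * ε + (-U * σ₀ ^ 2 - 2 * M * σ₀) + Γ) + μ' * ((gibbsState β B totalNumber).re / (L : ℝ) ^ 2) +
            U * ((gibbsState β B totalNumber).re / (L : ℝ) ^ 2) ^ 2 / 4 +
            ((2 * Real.pi * (β / 4 * 2 * (2 + 2 * Real.sqrt 2 * |h|))) * 2 + (2 * Real.pi * (5 / 4 * 2 * (2 + 2 * Real.sqrt 2 * |h|))) * 2 + |-2 * U * σ₀ - 2 * M| * (2 * Real.pi * (β / 4 * 2 * (2 + 2 * Real.sqrt 2 * |h|)))) / (L : ℝ) := by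
  intro L hL hev _
  obtain ⟨k, rfl⟩ := even_iff_exists_two_mul.mp hev
  have hk3 : 3 ≤ 2 * k := hk₁.trans hL
  have hLpos : (0 : ℝ) < ((2 * k : ℕ) : ℝ) := by exact_mod_cast (show 0 < 2 * k by omega)
  have hL₁pos : (0 : ℝ) < ((2 * k₁ : ℕ) : ℝ) := by exact_mod_cast (show 0 < 2 * k₁ by omega)
  have hL2 : (0 : ℝ) < ((2 * k : ℕ) : ℝ) ^ 2 := by positivity
  have hKd : (0 : ℝ) ≤ (2 * Real.pi * (β / 4 * 2 * (2 + 2 * Real.sqrt 2 * |h|))) := by positivity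
  have hKe : (0 : ℝ) ≤ (2 * Real.pi * (5 / 4 * 2 * (2 + 2 * Real.sqrt 2 * |h|))) := by positivity
  refine ⟨dWaveSourceTorus (2 * k) 0 μ' h +
      ∑ x : FermionTorus 2 (2 * k), ((M * neelSign x.toTorusSite : ℝ) : ℂ) • (numberOp x 0 - numberOp x 1),
    isHermitian_dWaveSourceTorus_add_spinField (2 * k) μ' h (fun x => M * neelSign x.toTorusSite), ?_⟩
  -- the two expectation rows in momentum space (compact form)
  rw [dWaveSourceTorusTT'_zero_tp, re_gibbsState_afTrial_totalNumber_eq k hk3 μ' h M β,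
    re_gibbsState_afTrial_dWaveSourceTorus_eq_compact k hk3 U μ' h M β]
  -- the two-grid controls between `2k` and `2k₁`
  have keyc := abs_afDensityCoeff_two_grid_le (2 * k) (2 * k₁) hβ hμ hM h (M := M)
  have keyq := abs_afMomentCoeff_two_grid_le (2 * k) (2 * k₁) hβ hμ hM h (M := M)
  have keyw := abs_afEnergyCoeff_two_grid_le (2 * k) (2 * k₁) (β := β) hμ hM h (M := M)
  generalize (∑ q : TorusSite 2 (2 * k), (1 / 2 - Real.tanh (β * Real.sqrt ((Real.sqrt (torusBand (2 * k) q ^ 2 + M ^ 2) + |μ'|) ^ 2 + (2 * Real.sqrt 2 * h * dWaveGap q) ^ 2) / 2) / (2 * Real.sqrt ((Real.sqrt (torusBand (2 * k) q ^ 2 + M ^ 2) + |μ'|) ^ 2 + (2 * Real.sqrt 2 * h * dWaveGap q) ^ 2)) * ((torusBand (2 * k) q - μ') / 2 - μ' / (2 * |μ'| * Real.sqrt (torusBand (2 * k) q ^ 2 + M ^ 2)) * (torusBand (2 * k) q ^ 2 + M ^ 2 - torusBand (2 * k) q * μ')) - Real.tanh (β * Real.sqrt ((Real.sqrt (torusBand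 (2 * k) q ^ 2 + M ^ 2) - |μ'|) ^ 2 + (2 * Real.sqrt 2 * h * dWaveGap q) ^ 2) / 2) / (2 * Real.sqrt ((Real.sqrt (torusBand (2 * k) q ^ 2 + M ^ 2) - |μ'|) ^ 2 + (2 * Real.sqrt 2 * h * dWaveGap q) ^ 2)) * ((torusBand (2 * k) q - μ') / 2 + μ' / (2 * |μ'| * Real.sqrt (torusBand (2 * k) q ^ 2 + M ^ 2)) * (torusBand (2 * k) q ^ 2 + M ^ 2 - torusBand (2 * k) q * μ')))) = Sc at keyc ⊢
  generalize (∑ q : TorusSite 2 (2 * k), (-M * (Real.tanh (β * Real.sqrt ((Real.sqrt (torusBand (2 * k) q ^ 2 + M ^ 2) + |μ'|) ^ 2 + (2 * Real.sqrt 2 * h * dWaveGap q) ^ 2) / 2) / (2 * Real.sqrt ((Real.sqrt (torusBand (2 * k) q ^ 2 + M ^ 2) + |μ'|) ^ 2 + (2 * Real.sqrt 2 * h * dWaveGap q) ^ 2)) * (1 / 2 + μ' / (2 * |μ'| * Real.sqrt (torusBand (2 * k) q ^ 2 + M ^ 2)) * μ') + Real.tanh (β * Real.sqrt ((Real.sqrt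 (torusBand (2 * k) q ^ 2 + M ^ 2) - |μ'|) ^ 2 + (2 * Real.sqrt 2 * h * dWaveGap q) ^ 2) / 2) / (2 * Real.sqrt ((Real.sqrt (torusBand (2 * k) q ^ 2 + M ^ 2) - |μ'|) ^ 2 + (2 * Real.sqrt 2 * h * dWaveGap q) ^ 2)) * (1 / 2 - μ' / (2 * |μ'| * Real.sqrt (torusBand (2 * k) q ^ 2 + M ^ 2)) * μ')))) = Sq at keyq ⊢
  generalize (∑ q : TorusSite 2 (2 * k), ((torusBand (2 * k) q - μ') * (1 / 2 - Real.tanh (β * Real.sqrt ((Real.sqrt (torusBand (2 * k) q ^ 2 + M ^ 2) + |μ'|) ^ 2 + (2 * Real.sqrt 2 * h * dWaveGap q) ^ 2) / 2) / (2 * Real.sqrt ((Real.sqrt (torusBand (2 * k) q ^ 2 + M ^ 2) + |μ'|) ^ 2 + (2 * Real.sqrt 2 * h * dWaveGap q) ^ 2)) * ((torusBand (2 * k) q - μ') / 2 - μ' / (2 * |μ'| * Real.sqrt (torusBand (2 * k) q ^ 2 + M ^ 2)) * (torusBand (2 * k) q ^ 2 + M ^ 2 - torusBand (2 * k) q * μ'))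 - Real.tanh (β * Real.sqrt ((Real.sqrt (torusBand (2 * k) q ^ 2 + M ^ 2) - |μ'|) ^ 2 + (2 * Real.sqrt 2 * h * dWaveGap q) ^ 2) / 2) / (2 * Real.sqrt ((Real.sqrt (torusBand (2 * k) q ^ 2 + M ^ 2) - |μ'|) ^ 2 + (2 * Real.sqrt 2 * h * dWaveGap q) ^ 2)) * ((torusBand (2 * k) q - μ') / 2 + μ' / (2 * |μ'| * Real.sqrt (torusBand (2 * k) q ^ 2 + M ^ 2)) * (torusBand (2 * k) q ^ 2 + M ^ 2 - torusBand (2 * k) q * μ'))) + (2 * Real.sqrt 2 * h * dWaveGap q) * (-(2 * Real.sqrt 2 * h * dWaveGap q) * (Real.tanh (β * Real.sqrt ((Real.sqrt (torusBand (2 * k) q ^ 2 + M ^ 2) + |μ'|) ^ 2 + (2 * Real.sqrt 2 * h * dWaveGap q) ^ 2) / 2) / (2 * Real.sqrt ((Real.sqrt (torusBand (2 * k) q ^ 2 + M ^ 2) + |μ'|) ^ 2 + (2 * Real.sqrt 2 * h * dWaveGap q) ^ 2)) * (1 / 2 - μ' / (2 * |μ'| * Real.sqrt (torusBand (2 * k)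 q ^ 2 + M ^ 2)) * torusBand (2 * k) q) + Real.tanh (β * Real.sqrt ((Real.sqrt (torusBand (2 * k) q ^ 2 + M ^ 2) - |μ'|) ^ 2 + (2 * Real.sqrt 2 * h * dWaveGap q) ^ 2) / 2) / (2 * Real.sqrt ((Real.sqrt (torusBand (2 * k) q ^ 2 + M ^ 2) - |μ'|) ^ 2 + (2 * Real.sqrt 2 * h * dWaveGap q) ^ 2)) * (1 / 2 + μ' / (2 * |μ'| * Real.sqrt (torusBand (2 * k) q ^ 2 + M ^ 2)) * torusBand (2 * k) q))) + M * (-M * (Real.tanh (β * Real.sqrt ((Real.sqrt (torusBand (2 * k) q ^ 2 + M ^ 2) + |μ'|) ^ 2 + (2 * Real.sqrt 2 * h * dWaveGap q) ^ 2) / 2) / (2 * Real.sqrt ((Real.sqrt (torusBand (2 * k) q ^ 2 + M ^ 2) + |μ'|) ^ 2 + (2 * Real.sqrt 2 * h * dWaveGap q) ^ 2)) * (1 / 2 + μ' / (2 * |μ'| * Real.sqrt (torusBand (2 * k) q ^ 2 + M ^ 2)) * μ') + Real.tanh (β * Real.sqrt ((Real.sqrt (torusBand (2 * k) q ^ 2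 + M ^ 2) - |μ'|) ^ 2 + (2 * Real.sqrt 2 * h * dWaveGap q) ^ 2) / 2) / (2 * Real.sqrt ((Real.sqrt (torusBand (2 * k) q ^ 2 + M ^ 2) - |μ'|) ^ 2 + (2 * Real.sqrt 2 * h * dWaveGap q) ^ 2)) * (1 / 2 - μ' / (2 * |μ'| * Real.sqrt (torusBand (2 * k) q ^ 2 + M ^ 2)) * μ'))))) = Swk at keyw ⊢
  generalize (∑ p : TorusSite 2 (2 * k₁), (1 / 2 - Real.tanh (β * Real.sqrt ((Real.sqrt (torusBand (2 * k₁) p ^ 2 + M ^ 2) + |μ'|) ^ 2 + (2 * Real.sqrt 2 * h * dWaveGap p) ^ 2) / 2) / (2 * Real.sqrt ((Real.sqrt (torusBand (2 * k₁) p ^ 2 + M ^ 2) + |μ'|) ^ 2 + (2 * Real.sqrt 2 * h * dWaveGap p) ^ 2)) * ((torusBand (2 * k₁) p - μ') / 2 - μ' / (2 * |μ'| * Real.sqrt (torusBand (2 * k₁) p ^ 2 + M ^ 2)) * (torusBand (2 * k₁) p ^ 2 + M ^ 2 - torusBand (2 * k₁) p * μ')) - Real.tanh (β * Real.sqrt ((Real.sqrt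 (torusBand (2 * k₁) p ^ 2 + M ^ 2) - |μ'|) ^ 2 + (2 * Real.sqrt 2 * h * dWaveGap p) ^ 2) / 2) / (2 * Real.sqrt ((Real.sqrt (torusBand (2 * k₁) p ^ 2 + M ^ 2) - |μ'|) ^ 2 + (2 * Real.sqrt 2 * h * dWaveGap p) ^ 2)) * ((torusBand (2 * k₁) p - μ') / 2 + μ' / (2 * |μ'| * Real.sqrt (torusBand (2 * k₁) p ^ 2 + M ^ 2)) * (torusBand (2 * k₁) p ^ 2 + M ^ 2 - torusBand (2 * k₁) p * μ')))) = Sc₁ at keyc ha hb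
  generalize (∑ p : TorusSite 2 (2 * k₁), (-M * (Real.tanh (β * Real.sqrt ((Real.sqrt (torusBand (2 * k₁) p ^ 2 + M ^ 2) + |μ'|) ^ 2 + (2 * Real.sqrt 2 * h * dWaveGap p) ^ 2) / 2) / (2 * Real.sqrt ((Real.sqrt (torusBand (2 * k₁) p ^ 2 + M ^ 2) + |μ'|) ^ 2 + (2 * Real.sqrt 2 * h * dWaveGap p) ^ 2)) * (1 / 2 + μ' / (2 * |μ'| * Real.sqrt (torusBand (2 * k₁) p ^ 2 + M ^ 2)) * μ') + Real.tanh (β * Real.sqrt ((Real.sqrt (torusBand (2 * k₁) p ^ 2 + M ^ 2) - |μ'|) ^ 2 + (2 * Real.sqrt 2 * h * dWaveGap p) ^ 2) / 2) / (2 * Real.sqrt ((Real.sqrt (torusBand (2 * k₁) p ^ 2 + M ^ 2) - |μ'|) ^ 2 + (2 * Real.sqrt 2 * h * dWaveGap p) ^ 2)) * (1 / 2 - μ' / (2 * |μ'| * Real.sqrt (torusBand (2 * k₁) p ^ 2 + M ^ 2)) * μ')))) = Sq₁ at keyq hsq htq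
  generalize (∑ p : TorusSite 2 (2 * k₁), ((torusBand (2 * k₁) p - μ') * (1 / 2 - Real.tanh (β * Real.sqrt ((Real.sqrt (torusBand (2 * k₁) p ^ 2 + M ^ 2) + |μ'|) ^ 2 + (2 * Real.sqrt 2 * h * dWaveGap p) ^ 2) / 2) / (2 * Real.sqrt ((Real.sqrt (torusBand (2 * k₁) p ^ 2 + M ^ 2) + |μ'|) ^ 2 + (2 * Real.sqrt 2 * h * dWaveGap p) ^ 2)) * ((torusBand (2 * k₁) p - μ') / 2 - μ' / (2 * |μ'| * Real.sqrt (torusBand (2 * k₁) p ^ 2 + M ^ 2)) * (torusBand (2 * k₁) p ^ 2 + M ^ 2 - torusBand (2 * k₁) p * μ')) - Real.tanh (β * Real.sqrt ((Real.sqrt (torusBand (2 * k₁) p ^ 2 + M ^ 2) - |μ'|) ^ 2 + (2 * Real.sqrt 2 * h * dWaveGap p) ^ 2) / 2) / (2 * Real.sqrt ((Real.sqrt (torusBand (2 * k₁) p ^ 2 + M ^ 2) - |μ'|) ^ 2 + (2 * Real.sqrt 2 * h * dWaveGap p) ^ 2)) * ((torusBand (2 * k₁) p - μ') / 2 + μ'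 / (2 * |μ'| * Real.sqrt (torusBand (2 * k₁) p ^ 2 + M ^ 2)) * (torusBand (2 * k₁) p ^ 2 + M ^ 2 - torusBand (2 * k₁) p * μ'))) + (2 * Real.sqrt 2 * h * dWaveGap p) * (-(2 * Real.sqrt 2 * h * dWaveGap p) * (Real.tanh (β * Real.sqrt ((Real.sqrt (torusBand (2 * k₁) p ^ 2 + M ^ 2) + |μ'|) ^ 2 + (2 * Real.sqrt 2 * h * dWaveGap p) ^ 2) / 2) / (2 * Real.sqrt ((Real.sqrt (torusBand (2 * k₁) p ^ 2 + M ^ 2) + |μ'|) ^ 2 + (2 * Real.sqrt 2 * h * dWaveGap p) ^ 2)) * (1 / 2 - μ' / (2 * |μ'| * Real.sqrt (torusBand (2 * k₁) p ^ 2 + M ^ 2)) * torusBand (2 * k₁) p) + Real.tanh (β * Real.sqrt ((Real.sqrt (torusBand (2 * k₁) p ^ 2 + M ^ 2) - |μ'|) ^ 2 + (2 * Real.sqrt 2 * h * dWaveGap p) ^ 2) / 2) / (2 * Real.sqrt ((Real.sqrt (torusBand (2 * k₁) p ^ 2 + M ^ 2) - |μ'|) ^ 2 + (2 * Real.sqrt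 2 * h * dWaveGap p) ^ 2)) * (1 / 2 + μ' / (2 * |μ'| * Real.sqrt (torusBand (2 * k₁) p ^ 2 + M ^ 2)) * torusBand (2 * k₁) p))) + M * (-M * (Real.tanh (β * Real.sqrt ((Real.sqrt (torusBand (2 * k₁) p ^ 2 + M ^ 2) + |μ'|) ^ 2 + (2 * Real.sqrt 2 * h * dWaveGap p) ^ 2) / 2) / (2 * Real.sqrt ((Real.sqrt (torusBand (2 * k₁) p ^ 2 + M ^ 2) + |μ'|) ^ 2 + (2 * Real.sqrt 2 * h * dWaveGap p) ^ 2)) * (1 / 2 + μ' / (2 * |μ'| * Real.sqrt (torusBand (2 * k₁) p ^ 2 + M ^ 2)) * μ') + Real.tanh (β * Real.sqrt ((Real.sqrt (torusBand (2 * k₁) p ^ 2 + M ^ 2) - |μ'|) ^ 2 + (2 * Real.sqrt 2 * h * dWaveGap p) ^ 2) / 2) / (2 * Real.sqrt ((Real.sqrt (torusBand (2 * k₁) p ^ 2 + M ^ 2) - |μ'|) ^ 2 + (2 * Real.sqrt 2 * h * dWaveGap p) ^ 2)) * (1 / 2 - μ' / (2 * |μ'| * Real.sqrt (torusBand (2 *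 k₁) p ^ 2 + M ^ 2)) * μ'))))) = Sw₁ at keyw hsw
  generalize hKdg : (2 * Real.pi * (β / 4 * 2 * (2 + 2 * Real.sqrt 2 * |h|))) = Kδ at hKd hδ keyc keyq ⊢
  generalize hKeg : (2 * Real.pi * (5 / 4 * 2 * (2 + 2 * Real.sqrt 2 * |h|))) = Kε at hKe hε keyw ⊢
  generalize hγ : (-2 * U * σ₀ - 2 * M) = γ at hΓ1 hΓ2 ⊢
  -- per-site quantities on the torus `2k`
  set ν := Sc / ((2 * k : ℕ) : ℝ) ^ 2 with hν
  set σ := Sq / ((2 * k : ℕ) : ℝ) ^ 2 with hσ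
  set ω := Swk / ((2 * k : ℕ) : ℝ) ^ 2 with hω
  have h1L : 0 < 1 / ((2 * k : ℕ) : ℝ) := by positivity
  -- grid-to-grid slacks: |ν − ν₁| ≤ Kδ(1/L + 1/L₁) ≤ δ + Kδ/L, etc.
  have hν_lo : a - δ - Kδ / ((2 * k : ℕ) : ℝ) ≤ ν := by
    have := neg_abs_le (Sc / ((2 * k : ℕ) : ℝ) ^ 2 - Sc₁ / ((2 * k₁ : ℕ) : ℝ) ^ 2)
    have e1 : Kδ * (1 / ((2 * k : ℕ) : ℝ) + 1 / ((2 * k₁ : ℕ) : ℝ)) = Kδ / ((2 * k : ℕ) : ℝ) + Kδ / ((2 * k₁ : ℕ) : ℝ) := by ring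
    rw [hν]; linarith
  have hν_hi : ν ≤ b + δ + Kδ / ((2 * k : ℕ) : ℝ) := by
    have := le_abs_self (Sc / ((2 * k : ℕ) : ℝ) ^ 2 - Sc₁ / ((2 * k₁ : ℕ) : ℝ) ^ 2)
    have e1 : Kδ * (1 / ((2 * k : ℕ) : ℝ) + 1 / ((2 * k₁ : ℕ) : ℝ)) = Kδ / ((2 * k : ℕ) : ℝ) + Kδ / ((2 * k₁ : ℕ) : ℝ) := by ring
    rw [hν]; linarith
  have hσ_lo : sq - δ - Kδ / ((2 * k : ℕ) : ℝ) ≤ σ := by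
    have := neg_abs_le (Sq / ((2 * k : ℕ) : ℝ) ^ 2 - Sq₁ / ((2 * k₁ : ℕ) : ℝ) ^ 2)
    have e1 : Kδ * (1 / ((2 * k : ℕ) : ℝ) + 1 / ((2 * k₁ : ℕ) : ℝ)) = Kδ / ((2 * k : ℕ) : ℝ) + Kδ / ((2 * k₁ : ℕ) : ℝ) := by ring
    rw [hσ]; linarith
  have hσ_hi : σ ≤ tq + δ + Kδ / ((2 * k : ℕ) : ℝ) := by
    have := le_abs_self (Sq / ((2 * k : ℕ) : ℝ) ^ 2 - Sq₁ / ((2 * k₁ : ℕ) : ℝ) ^ 2)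
    have e1 : Kδ * (1 / ((2 * k : ℕ) : ℝ) + 1 / ((2 * k₁ : ℕ) : ℝ)) = Kδ / ((2 * k : ℕ) : ℝ) + Kδ / ((2 * k₁ : ℕ) : ℝ) := by ring
    rw [hσ]; linarith
  have hω_hi : ω ≤ sw + ε + Kε / ((2 * k : ℕ) : ℝ) := by
    have := le_abs_self (Swk / ((2 * k : ℕ) : ℝ) ^ 2 - Sw₁ / ((2 * k₁ : ℕ) : ℝ) ^ 2)
    have e1 : Kε * (1 / ((2 * k : ℕ) : ℝ) + 1 / ((2 * k₁ : ℕ) : ℝ)) = Kε / ((2 * k : ℕ) : ℝ) + Kε / ((2 * k₁ : ℕ) : ℝ) := by ring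
    rw [hω]; linarith
  -- the moment energy below its tangent at `σ₀`, and the tangent over the σ-box
  have hconc : -U * σ ^ 2 - 2 * M * σ ≤ (-U * σ₀ ^ 2 - 2 * M * σ₀) + γ * (σ - σ₀) := by
    rw [← hγ]; nlinarith [sq_nonneg (σ - σ₀)]
  have htan : γ * (σ - σ₀) ≤ Γ + |γ| * (Kδ / ((2 * k : ℕ) : ℝ)) := by
    -- `γ(σ − σ₀)` is affine in `σ ∈ [sq − δ − Kδ/L, tq + δ + Kδ/L]`
    have hKL : 0 ≤ Kδ / ((2 * k : ℕ) : ℝ) := div_nonneg hKd hLpos.le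
    rcases le_or_gt 0 γ with hg | hg
    · have : γ * (σ - σ₀) ≤ γ * (tq + δ - σ₀) + γ * (Kδ / ((2 * k : ℕ) : ℝ)) := by nlinarith
      rw [abs_of_nonneg hg]; linarith
    · have : γ * (σ - σ₀) ≤ γ * (sq - δ - σ₀) + (-γ) * (Kδ / ((2 * k : ℕ) : ℝ)) := by nlinarith
      rw [abs_of_neg hg]; linarith
  -- assemble the three rows
  have hn : 2 * Sc / ((2 * k : ℕ) : ℝ) ^ 2 = 2 * ν := by rw [hν]; ring
  have hcL : (Kδ * 2 + Kε * 2 + |γ| * Kδ) / ((2 * k : ℕ) : ℝ) =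
      2 * (Kδ / ((2 * k : ℕ) : ℝ)) + 2 * (Kε / ((2 * k : ℕ) : ℝ)) + |γ| * (Kδ / ((2 * k : ℕ) : ℝ)) := by ring
  have hKdL : 0 ≤ Kδ / ((2 * k : ℕ) : ℝ) := div_nonneg hKd hLpos.le
  have hKeL : 0 ≤ Kε / ((2 * k : ℕ) : ℝ) := div_nonneg hKe hLpos.le
  have hγabs : 0 ≤ |γ| * (Kδ / ((2 * k : ℕ) : ℝ)) := mul_nonneg (abs_nonneg _) hKdL
  refine ⟨?_, ?_, ?_⟩
  · rw [hn, hcL]; linarith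
  · rw [hn, hcL]; linarith
  · have he : (2 * Swk + μ' * (2 * Sc) + U * ((2 * Sc) ^ 2 / (4 * ((2 * k : ℕ) : ℝ) ^ 2) - Sq ^ 2 / ((2 * k : ℕ) : ℝ) ^ 2) -
        2 * M * Sq) / ((2 * k : ℕ) : ℝ) ^ 2 =
        2 * ω + μ' * (2 * ν) + U * (2 * ν) ^ 2 / 4 + (-U * σ ^ 2 - 2 * M * σ) := by
      rw [hω, hν, hσ]; field_simp; ring
    rw [hn, he, hcL]
    nlinarith [hω_hi, hconc, htan, hKdL, hKeL, hγabs, hU]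

end AFRows

end Summit.Ventures.CertifiedManyBodySolver.Observables
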